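import Literature.NumberTheory.LFunctions.Zhang2022.RepairWindowFormClosedB
import Literature.NumberTheory.LFunctions.Zhang2022.RepairResidualBoxes

/-!
# Zhang (2022) §18-margin repair rung F-S1R, K-S2 annex: interval boxes of the five window integrals
# `J₁ … J₅` of `RepairWindowFormClosedB` (both branches) and of the one-window combination
# `−(8/π)J₁ + 88πJ₂ − 24i(J₃+J₄) − 48π²iJ₅`

Trunk T-ANT (NumberTheory/LFunctions). Y. Zhang, *Discrete mean estimates and the Landau–Siegel
zero*, arXiv:2211.02515v1 (2022) [Zhang2022LandauSiegel] — **an unrefereed manuscript under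
adjudication; nothing here asserts or denies its Theorems 1–2 or any analytic lemma; no claim about
Landau–Siegel zeros is made.** Rung F-S1R (D-0077), seat repair-p4; the evaluation layer p1's K-S2 chain
stops short of (`RepairWindowFormClosedB`: "ready for p5's box primitives at any rational point").

p1's `discS_eq_window_integrals` writes the K-S2 discrepancy of record `discS θ = 𝔠₃ˢ(θ) − 𝔠₃ʳ(θ)`
(exact bilinear cross term minus the transcribed reduced one) on the admissible class as
`ῑ₄·K(ν₁,k₁;ν₂,k₂) + ῑ₃·K(ν₁,k₁;ν₃,k₃) − 2e₂*(θ)`, `K = −(8/π)J₁ + 88πJ₂ − 24i(J₃+J₄) − 48π²iJ₅`, and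
`J1w_closed_of_ne/_of_eq … J5w_closed_of_ne/_of_eq` give each `J` as `(1/(ν_aν_b))·e^{iπk_aL}·expQuadIntR(…)`
(`k_b ≠ k_a`) or `·polyInt(…)` (`k_b = k_a`), `L = ν_a + ν_b − 1`. This file turns those closed forms into
fixed-point boxes for RATIONAL shifts and interval lengths/windows, through p5's primitives
(`expQuadIntBL`, `polyIntB`, `expIpiFI`, `overPiFI`, `recipFI`; `RepairResidualBoxes.aPiI`):

* `J1Bne … J5Bne (ka kb : ℚ) (Va Vb LI : FI)` with `mem_J1Bne … mem_J5Bne` (`k_b ≠ k_a`; flag `JOKne`);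
* `J1Beq … J5Beq (k : ℚ) (Va Vb LI : FI)` with `mem_J1Beq … mem_J5Beq` (`k_b = k_a = k ≠ 0`; flag `JOKeq`);
* `KwBne/KwBeq` with `mem_KwBne/mem_KwBeq`: boxes of the combination `K` in exactly the syntactic shape of
  `discS_eq_window_integrals`.

Consumed by `RepairDiscSCert` (kernel balls of `discS θ₀` — the optional [Q2-3] slot — and of `discS(W)`,
hence `C232S(W) < 0.001`). Pure interval bookkeeping; no analytic content, no new `Prop` facts, nothing
about Theorems 1–2.

## References

* Y. Zhang, arXiv:2211.02515v1 (2022), §12 (12.12)–(12.17), §18 (18.1)–(18.2). [cite: Zhang2022LandauSiegel, §§12, 18]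
* R. E. Moore, *Interval Analysis*, Prentice-Hall (1966), Theorem 3.1. [Moore1966]
-/

noncomputable section

open Complex Real ComplexConjugate
open Literature.Analysis.ValidatedNumerics.Numerics

namespace Literature.NumberTheory.LFunctions.Zhang2022

namespace Repair

attribute [local irreducible] CB.add CB.sub CB.mul CB.neg CB.conj CB.mulFI CB.mulI CB.mulInt
  CB.ofFI CB.ofInt CB.normSqFI CB.expI FI.add FI.sub FI.mul FI.neg FI.mulInt FI.divNat FI.divPos
  FI.ofRat FI.ofInt FI.pi qCB piMul expIpi overPiFI piISq mulPiFI scaleRatFI recipFI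
  recipMulPiFI expIpiFI

variable {νa νb : ℝ} {ka kb k : ℚ} {Va Vb LI : FI}

/-! ### Shapes shared by all five integrals -/

/-- the prefactor `1/(ν_aν_b)` moved to the right as `(1/ν_a)(1/ν_b)`. [folklore] -/
private theorem pref_mul (νa νb : ℝ) (X : ℂ) :
    (((1 / (νa * νb) : ℝ)) : ℂ) * X = X * ((((1 / νa) * (1 / νb) : ℝ)) : ℂ) := by
  rw [one_div_mul_one_div]; ring

/-- the same with a sign. [folklore] -/
private theorem neg_pref_mul (νa νb : ℝ) (X : ℂ) :
    -(((1 / (νa * νb) : ℝ)) : ℂ) * X = -(X * ((((1 / νa) * (1 / νb) : ℝ)) : ℂ)) := by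
  rw [one_div_mul_one_div]; ring

/-- the phase `e^{iπk_aL}` in the shape of `expIpiFI`. [folklore] -/
private theorem phase_shape (ka : ℚ) (L : ℝ) :
    cexp ((((ka : ℝ)) : ℂ) * π * I * ((L : ℝ) : ℂ)) = cexp (((((ka : ℝ) * L * π : ℝ)) : ℂ) * I) := by
  congr 1; push_cast; ring

/-- box of the prefactor `(1/ν_a)(1/ν_b)`. [folklore] -/
def prefFI (Va Vb : FI) : FI := (recipFI Va).mul (recipFI Vb)

/-- `(1/ν_a)(1/ν_b) ∈ prefFI Va Vb`. [cite: Moore1966, Theorem 3.1] -/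
theorem mem_prefFI (ha : FI.mem νa Va) (hb : FI.mem νb Vb) (hA : recipOK Va = true) (hB : recipOK Vb = true) :
    FI.mem ((1 / νa) * (1 / νb)) (prefFI Va Vb) := by
  unfold prefFI; exact FI.mem_mul (mem_recipFI hA ha) (mem_recipFI hB hb)

/-- box of the phase `e^{iπk_aL}`, `L ∈ LI`. [folklore] -/
def phaseB (ka : ℚ) (LI : FI) : CB := expIpiFI (scaleRatFI LI ka)

/-- `e^{iπk_aL} ∈ phaseB ka LI`. [cite: Moore1966, Theorem 3.1] -/
theorem mem_phaseB {L : ℝ} (hL : FI.mem L LI) (ka : ℚ) (hE : expIpiFIOK (scaleRatFI LI ka) = true) :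
    CB.mem (cexp ((((ka : ℝ)) : ℂ) * π * I * ((L : ℝ) : ℂ))) (phaseB ka LI) := by
  rw [phase_shape]; unfold phaseB; exact mem_expIpiFI hE (mem_scaleRatFI hL ka)

/-- `(k_b − k_a : ℝ)` as the cast of the rational difference. [folklore] -/
private theorem freq_cast (ka kb : ℚ) : ((kb : ℝ) - (ka : ℝ)) = ((kb - ka : ℚ) : ℝ) := by push_cast; ring

/-- box of `1 + k_aπi·L`. [folklore] -/
def q1L (ka : ℚ) (LI : FI) : CB := (CB.ofInt 1).add ((aPiI ka).mul (CB.ofFI LI))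

/-- `1 + k_aπiL ∈ q1L ka LI`. [cite: Moore1966, Theorem 3.1] -/
theorem mem_q1L {L : ℝ} (hL : FI.mem L LI) (ka : ℚ) :
    CB.mem (1 + (((ka : ℝ)) : ℂ) * π * I * ((L : ℝ) : ℂ)) (q1L ka LI) := by
  unfold q1L; exact CB.mem_add mem_zero_one.2 (CB.mem_mul (mem_aPiI ka) (CB.mem_ofFI hL))

/-- validity flags, oscillatory branch `k_b ≠ k_a` (reciprocals, phase, `expQuadIntBL` at frequency
`k_b − k_a` and — for `J₅`'s second piece — at `−k_a`). [folklore] -/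
def JOKne (ka kb : ℚ) (Va Vb LI : FI) : Bool :=
  recipOK Va && recipOK Vb && expIpiFIOK (scaleRatFI LI ka) && overPiOK (kb - ka)⁻¹
    && expIpiFIOK (scaleRatFI LI (kb - ka)) && overPiOK kb⁻¹ && overPiOK (-ka)⁻¹
    && expIpiFIOK (scaleRatFI LI (-ka))

/-- validity flags, resonant branch `k_b = k_a = k`. [folklore] -/
def JOKeq (k : ℚ) (Va Vb LI : FI) : Bool :=
  recipOK Va && recipOK Vb && expIpiFIOK (scaleRatFI LI k) && overPiOK k⁻¹ && overPiOK (-k)⁻¹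
    && expIpiFIOK (scaleRatFI LI (-k))

/-! ### `J₁` -/

/-- box of `J₁`, `k_b ≠ k_a`. [cite: Zhang2022LandauSiegel, §12 (12.12)–(12.14)] -/
@[irreducible] def J1Bne (ka kb : ℚ) (Va Vb LI : FI) : CB :=
  ((phaseB ka LI).mul (expQuadIntBL (q1L ka LI) (((q1L ka LI).mul (aPiI kb)).sub (aPiI ka))
    (((aPiI ka).neg).mul (aPiI kb)) (kb - ka) LI)).mulFI (prefFI Va Vb)

/-- box of `J₁`, `k_b = k_a = k`. [cite: Zhang2022LandauSiegel, §12 (12.12)–(12.14)] -/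
@[irreducible] def J1Beq (k : ℚ) (Va Vb LI : FI) : CB :=
  ((phaseB k LI).mul (polyIntB (q1L k LI) (((q1L k LI).mul (aPiI k)).sub (aPiI k))
    (((aPiI k).neg).mul (aPiI k)) LI)).mulFI (prefFI Va Vb)

/-- **`J₁ ∈ J1Bne`** (`k_b ≠ k_a`). [cite: Moore1966, Theorem 3.1] -/
theorem mem_J1Bne (ha : FI.mem νa Va) (hb : FI.mem νb Vb) (hL : FI.mem (νa + νb - 1) LI) (hk : kb - ka ≠ 0)
    (hok : JOKne ka kb Va Vb LI = true) :
    CB.mem (J1w νa (ka : ℝ) νb (kb : ℝ)) (J1Bne ka kb Va Vb LI) := by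
  simp only [JOKne, Bool.and_eq_true] at hok
  obtain ⟨⟨⟨⟨⟨⟨⟨hA, hB⟩, hE⟩, hU⟩, hE2⟩, -⟩, -⟩, -⟩ := hok
  have hk' : (kb : ℝ) - (ka : ℝ) ≠ 0 := by rw [freq_cast]; exact_mod_cast hk
  rw [J1w_closed_of_ne hk', freq_cast, expQuadIntR_ratCast, pref_mul]
  unfold J1Bne
  exact CB.mem_mulFI (CB.mem_mul (mem_phaseB hL ka hE)
    (mem_expQuadIntBL (mem_q1L hL ka) (CB.mem_sub (CB.mem_mul (mem_q1L hL ka) (mem_aPiI kb)) (mem_aPiI ka))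
      (CB.mem_mul (CB.mem_neg (mem_aPiI ka)) (mem_aPiI kb)) hL hU hE2)) (mem_prefFI ha hb hA hB)

/-- **`J₁ ∈ J1Beq`** (`k_b = k_a`). [cite: Moore1966, Theorem 3.1] -/
theorem mem_J1Beq (ha : FI.mem νa Va) (hb : FI.mem νb Vb) (hL : FI.mem (νa + νb - 1) LI)
    (hok : JOKeq k Va Vb LI = true) :
    CB.mem (J1w νa (k : ℝ) νb (k : ℝ)) (J1Beq k Va Vb LI) := by
  simp only [JOKeq, Bool.and_eq_true] at hok
  obtain ⟨⟨⟨⟨⟨hA, hB⟩, hE⟩, -⟩, -⟩, -⟩ := hok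
  rw [J1w_closed_of_eq rfl, pref_mul]
  unfold J1Beq
  exact CB.mem_mulFI (CB.mem_mul (mem_phaseB hL k hE)
    (mem_polyIntB_real (mem_q1L hL k) (CB.mem_sub (CB.mem_mul (mem_q1L hL k) (mem_aPiI k)) (mem_aPiI k))
      (CB.mem_mul (CB.mem_neg (mem_aPiI k)) (mem_aPiI k)) hL)) (mem_prefFI ha hb hA hB)

/-! ### `J₂` -/

/-- box of `J₂`, `k_b ≠ k_a`. [cite: Zhang2022LandauSiegel, §12 (12.12)–(12.14)] -/
@[irreducible] def J2Bne (ka kb : ℚ) (Va Vb LI : FI) : CB :=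
  ((phaseB ka LI).mul (expQuadIntBL (CB.ofInt 0) (CB.ofFI LI) ((CB.ofInt 1).neg) (kb - ka) LI)).mulFI
    (prefFI Va Vb)

/-- box of `J₂`, `k_b = k_a = k`. [cite: Zhang2022LandauSiegel, §12 (12.12)–(12.14)] -/
@[irreducible] def J2Beq (k : ℚ) (Va Vb LI : FI) : CB :=
  ((phaseB k LI).mul (polyIntB (CB.ofInt 0) (CB.ofFI LI) ((CB.ofInt 1).neg) LI)).mulFI (prefFI Va Vb)

/-- **`J₂ ∈ J2Bne`** (`k_b ≠ k_a`). [cite: Moore1966, Theorem 3.1] -/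
theorem mem_J2Bne (ha : FI.mem νa Va) (hb : FI.mem νb Vb) (hνa : νa ≠ 0) (hνb : νb ≠ 0)
    (hL : FI.mem (νa + νb - 1) LI) (hk : kb - ka ≠ 0) (hok : JOKne ka kb Va Vb LI = true) :
    CB.mem (J2w νa (ka : ℝ) νb (kb : ℝ)) (J2Bne ka kb Va Vb LI) := by
  simp only [JOKne, Bool.and_eq_true] at hok
  obtain ⟨⟨⟨⟨⟨⟨⟨hA, hB⟩, hE⟩, hU⟩, hE2⟩, -⟩, -⟩, -⟩ := hok
  have hk' : (kb : ℝ) - (ka : ℝ) ≠ 0 := by rw [freq_cast]; exact_mod_cast hk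
  rw [J2w_closed_of_ne hνa hνb hk', freq_cast, expQuadIntR_ratCast, pref_mul]
  unfold J2Bne
  exact CB.mem_mulFI (CB.mem_mul (mem_phaseB hL ka hE)
    (mem_expQuadIntBL mem_zero_one.1 (CB.mem_ofFI hL) (CB.mem_neg mem_zero_one.2) hL hU hE2))
    (mem_prefFI ha hb hA hB)

/-- **`J₂ ∈ J2Beq`** (`k_b = k_a`). [cite: Moore1966, Theorem 3.1] -/
theorem mem_J2Beq (ha : FI.mem νa Va) (hb : FI.mem νb Vb) (hνa : νa ≠ 0) (hνb : νb ≠ 0)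
    (hL : FI.mem (νa + νb - 1) LI) (hok : JOKeq k Va Vb LI = true) :
    CB.mem (J2w νa (k : ℝ) νb (k : ℝ)) (J2Beq k Va Vb LI) := by
  simp only [JOKeq, Bool.and_eq_true] at hok
  obtain ⟨⟨⟨⟨⟨hA, hB⟩, hE⟩, -⟩, -⟩, -⟩ := hok
  rw [J2w_closed_of_eq hνa hνb rfl, pref_mul]
  unfold J2Beq
  exact CB.mem_mulFI (CB.mem_mul (mem_phaseB hL k hE)
    (mem_polyIntB_real mem_zero_one.1 (CB.mem_ofFI hL) (CB.mem_neg mem_zero_one.2) hL))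
    (mem_prefFI ha hb hA hB)

/-! ### `J₃` -/

/-- box of `J₃`, `k_b ≠ k_a`. [cite: Zhang2022LandauSiegel, §12 (12.12)–(12.14)] -/
@[irreducible] def J3Bne (ka kb : ℚ) (Va Vb LI : FI) : CB :=
  (((phaseB ka LI).mul (expQuadIntBL (CB.ofInt 0) (q1L ka LI) ((aPiI ka).neg) (kb - ka) LI)).mulFI
    (prefFI Va Vb)).neg

/-- box of `J₃`, `k_b = k_a = k`. [cite: Zhang2022LandauSiegel, §12 (12.12)–(12.14)] -/
@[irreducible] def J3Beq (k : ℚ) (Va Vb LI : FI) : CB :=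
  (((phaseB k LI).mul (polyIntB (CB.ofInt 0) (q1L k LI) ((aPiI k).neg) LI)).mulFI (prefFI Va Vb)).neg

/-- **`J₃ ∈ J3Bne`** (`k_b ≠ k_a`). [cite: Moore1966, Theorem 3.1] -/
theorem mem_J3Bne (ha : FI.mem νa Va) (hb : FI.mem νb Vb) (hνb : νb ≠ 0) (hL : FI.mem (νa + νb - 1) LI)
    (hk : kb - ka ≠ 0) (hok : JOKne ka kb Va Vb LI = true) :
    CB.mem (J3w νa (ka : ℝ) νb (kb : ℝ)) (J3Bne ka kb Va Vb LI) := by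
  simp only [JOKne, Bool.and_eq_true] at hok
  obtain ⟨⟨⟨⟨⟨⟨⟨hA, hB⟩, hE⟩, hU⟩, hE2⟩, -⟩, -⟩, -⟩ := hok
  have hk' : (kb : ℝ) - (ka : ℝ) ≠ 0 := by rw [freq_cast]; exact_mod_cast hk
  rw [J3w_closed_of_ne hνb hk', freq_cast, expQuadIntR_ratCast, neg_pref_mul]
  unfold J3Bne
  exact CB.mem_neg (CB.mem_mulFI (CB.mem_mul (mem_phaseB hL ka hE)
    (mem_expQuadIntBL mem_zero_one.1 (mem_q1L hL ka) (CB.mem_neg (mem_aPiI ka)) hL hU hE2))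
    (mem_prefFI ha hb hA hB))

/-- **`J₃ ∈ J3Beq`** (`k_b = k_a`). [cite: Moore1966, Theorem 3.1] -/
theorem mem_J3Beq (ha : FI.mem νa Va) (hb : FI.mem νb Vb) (hνb : νb ≠ 0) (hL : FI.mem (νa + νb - 1) LI)
    (hok : JOKeq k Va Vb LI = true) :
    CB.mem (J3w νa (k : ℝ) νb (k : ℝ)) (J3Beq k Va Vb LI) := by
  simp only [JOKeq, Bool.and_eq_true] at hok
  obtain ⟨⟨⟨⟨⟨hA, hB⟩, hE⟩, -⟩, -⟩, -⟩ := hok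
  rw [J3w_closed_of_eq hνb rfl, neg_pref_mul]
  unfold J3Beq
  exact CB.mem_neg (CB.mem_mulFI (CB.mem_mul (mem_phaseB hL k hE)
    (mem_polyIntB_real mem_zero_one.1 (mem_q1L hL k) (CB.mem_neg (mem_aPiI k)) hL))
    (mem_prefFI ha hb hA hB))

/-! ### `J₄` -/

/-- box of `J₄`'s linear coefficient `L·(k_bπi) − 1`. [folklore] -/
def q4L (kb : ℚ) (LI : FI) : CB := ((CB.ofFI LI).mul (aPiI kb)).sub (CB.ofInt 1)

/-- `L·(k_bπi) − 1 ∈ q4L kb LI`. [cite: Moore1966, Theorem 3.1] -/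
theorem mem_q4L {L : ℝ} (hL : FI.mem L LI) (kb : ℚ) :
    CB.mem (((L : ℝ) : ℂ) * ((((kb : ℝ)) : ℂ) * π * I) - 1) (q4L kb LI) := by
  unfold q4L; exact CB.mem_sub (CB.mem_mul (CB.mem_ofFI hL) (mem_aPiI kb)) mem_zero_one.2

/-- box of `J₄`, `k_b ≠ k_a`. [cite: Zhang2022LandauSiegel, §12 (12.12)–(12.14)] -/
@[irreducible] def J4Bne (ka kb : ℚ) (Va Vb LI : FI) : CB :=
  (((phaseB ka LI).mul (expQuadIntBL (CB.ofFI LI) (q4L kb LI) ((aPiI kb).neg) (kb - ka) LI)).mulFI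
    (prefFI Va Vb)).neg

/-- box of `J₄`, `k_b = k_a = k`. [cite: Zhang2022LandauSiegel, §12 (12.12)–(12.14)] -/
@[irreducible] def J4Beq (k : ℚ) (Va Vb LI : FI) : CB :=
  (((phaseB k LI).mul (polyIntB (CB.ofFI LI) (q4L k LI) ((aPiI k).neg) LI)).mulFI (prefFI Va Vb)).neg

/-- **`J₄ ∈ J4Bne`** (`k_b ≠ k_a`). [cite: Moore1966, Theorem 3.1] -/
theorem mem_J4Bne (ha : FI.mem νa Va) (hb : FI.mem νb Vb) (hνa : νa ≠ 0) (hL : FI.mem (νa + νb - 1) LI)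
    (hk : kb - ka ≠ 0) (hok : JOKne ka kb Va Vb LI = true) :
    CB.mem (J4w νa (ka : ℝ) νb (kb : ℝ)) (J4Bne ka kb Va Vb LI) := by
  simp only [JOKne, Bool.and_eq_true] at hok
  obtain ⟨⟨⟨⟨⟨⟨⟨hA, hB⟩, hE⟩, hU⟩, hE2⟩, -⟩, -⟩, -⟩ := hok
  have hk' : (kb : ℝ) - (ka : ℝ) ≠ 0 := by rw [freq_cast]; exact_mod_cast hk
  rw [J4w_closed_of_ne hνa hk', freq_cast, expQuadIntR_ratCast, neg_pref_mul]
  unfold J4Bne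
  exact CB.mem_neg (CB.mem_mulFI (CB.mem_mul (mem_phaseB hL ka hE)
    (mem_expQuadIntBL (CB.mem_ofFI hL) (mem_q4L hL kb) (CB.mem_neg (mem_aPiI kb)) hL hU hE2))
    (mem_prefFI ha hb hA hB))

/-- **`J₄ ∈ J4Beq`** (`k_b = k_a`). [cite: Moore1966, Theorem 3.1] -/
theorem mem_J4Beq (ha : FI.mem νa Va) (hb : FI.mem νb Vb) (hνa : νa ≠ 0) (hL : FI.mem (νa + νb - 1) LI)
    (hok : JOKeq k Va Vb LI = true) :
    CB.mem (J4w νa (k : ℝ) νb (k : ℝ)) (J4Beq k Va Vb LI) := by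
  simp only [JOKeq, Bool.and_eq_true] at hok
  obtain ⟨⟨⟨⟨⟨hA, hB⟩, hE⟩, -⟩, -⟩, -⟩ := hok
  rw [J4w_closed_of_eq hνa rfl, neg_pref_mul]
  unfold J4Beq
  exact CB.mem_neg (CB.mem_mulFI (CB.mem_mul (mem_phaseB hL k hE)
    (mem_polyIntB_real (CB.mem_ofFI hL) (mem_q4L hL k) (CB.mem_neg (mem_aPiI k)) hL))
    (mem_prefFI ha hb hA hB))

/-! ### `J₅` -/

/-- `1/(πk_b)²` and `i/(πk_b)` through `u = overPi k_b⁻¹ = 1/(πk_b)`. [folklore] -/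
private theorem u_shapes {kb : ℚ} (hk : kb ≠ 0) :
    (1 / ((π : ℂ) * (((kb : ℝ)) : ℂ)) ^ 2) = ((((overPi kb⁻¹) * (overPi kb⁻¹) : ℝ)) : ℂ) ∧
    (I / ((π : ℂ) * (((kb : ℝ)) : ℂ))) = (((overPi kb⁻¹ : ℝ)) : ℂ) * I := by
  unfold overPi
  have hk' : (kb : ℂ) ≠ 0 := by exact_mod_cast hk
  have hπ : (π : ℂ) ≠ 0 := by exact_mod_cast Real.pi_ne_zero
  constructor
  · push_cast; field_simp
  · push_cast; field_simp

/-- boxes of `u²` and `u·i`, `u = 1/(πk_b)`. [folklore] -/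
def u2B (kb : ℚ) : CB := CB.ofFI ((overPiFI kb⁻¹).mul (overPiFI kb⁻¹))
/-- [folklore] -/
def uIB (kb : ℚ) : CB := (CB.ofFI (overPiFI kb⁻¹)).mulI

/-- memberships of `u²`, `u·i`. [cite: Moore1966, Theorem 3.1] -/
theorem mem_uB {kb : ℚ} (hU : overPiOK kb⁻¹ = true) :
    CB.mem ((((overPi kb⁻¹) * (overPi kb⁻¹) : ℝ)) : ℂ) (u2B kb) ∧
    CB.mem ((((overPi kb⁻¹ : ℝ)) : ℂ) * I) (uIB kb) := by
  have hu := mem_overPiFI hU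
  unfold u2B uIB
  exact ⟨CB.mem_ofFI (FI.mem_mul hu hu), CB.mem_mulI (CB.mem_ofFI hu)⟩

/-- box of `J₅`, `k_b ≠ k_a` (second piece at frequency `−k_a`). [cite: Zhang2022LandauSiegel, §12 (12.12)–(12.14)] -/
@[irreducible] def J5Bne (ka kb : ℚ) (Va Vb LI : FI) : CB :=
  (((phaseB ka LI).mul (expQuadIntBL ((CB.ofFI LI).mul (u2B kb))
      (((u2B kb).neg).sub ((CB.ofFI LI).mul (uIB kb))) (uIB kb) (kb - ka) LI)).sub
    ((u2B kb).mul ((phaseB ka LI).mul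
      (expQuadIntBL (CB.ofFI LI) ((CB.ofInt 1).neg) (CB.ofInt 0) (-ka) LI)))).mulFI (prefFI Va Vb)

/-- box of `J₅`, `k_b = k_a = k`. [cite: Zhang2022LandauSiegel, §12 (12.12)–(12.14)] -/
@[irreducible] def J5Beq (k : ℚ) (Va Vb LI : FI) : CB :=
  (((phaseB k LI).mul (polyIntB ((CB.ofFI LI).mul (u2B k))
      (((u2B k).neg).sub ((CB.ofFI LI).mul (uIB k))) (uIB k) LI)).sub
    ((u2B k).mul ((phaseB k LI).mul
      (expQuadIntBL (CB.ofFI LI) ((CB.ofInt 1).neg) (CB.ofInt 0) (-k) LI)))).mulFI (prefFI Va Vb)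

/-- `(0 − k_a : ℝ)` as the cast of `−k_a`. [folklore] -/
private theorem neg_freq_cast (ka : ℚ) : ((0 : ℝ) - (ka : ℝ)) = ((-ka : ℚ) : ℝ) := by push_cast; ring

/-- **`J₅ ∈ J5Bne`** (`k_b ≠ k_a`, `k_a, k_b ≠ 0`). [cite: Moore1966, Theorem 3.1] -/
theorem mem_J5Bne (ha : FI.mem νa Va) (hb : FI.mem νb Vb) (hνa : νa ≠ 0) (hL : FI.mem (νa + νb - 1) LI)
    (hk : kb - ka ≠ 0) (hka : ka ≠ 0) (hkb : kb ≠ 0) (hok : JOKne ka kb Va Vb LI = true) :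
    CB.mem (J5w νa (ka : ℝ) νb (kb : ℝ)) (J5Bne ka kb Va Vb LI) := by
  simp only [JOKne, Bool.and_eq_true] at hok
  obtain ⟨⟨⟨⟨⟨⟨⟨hA, hB⟩, hE⟩, hU⟩, hE2⟩, hUb⟩, hUa⟩, hEa⟩ := hok
  have hk' : (kb : ℝ) - (ka : ℝ) ≠ 0 := by rw [freq_cast]; exact_mod_cast hk
  have hka' : (ka : ℝ) ≠ 0 := by exact_mod_cast hka
  obtain ⟨u1, u2⟩ := u_shapes hkb
  obtain ⟨m1, m2⟩ := mem_uB hUb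
  rw [J5w_closed_of_ne hνa hk' hka', u1, u2, freq_cast, neg_freq_cast, expQuadIntR_ratCast,
    expQuadIntR_ratCast, pref_mul]
  unfold J5Bne
  exact CB.mem_mulFI (CB.mem_sub
    (CB.mem_mul (mem_phaseB hL ka hE) (mem_expQuadIntBL (CB.mem_mul (CB.mem_ofFI hL) m1)
      (CB.mem_sub (CB.mem_neg m1) (CB.mem_mul (CB.mem_ofFI hL) m2)) m2 hL hU hE2))
    (CB.mem_mul m1 (CB.mem_mul (mem_phaseB hL ka hE) (mem_expQuadIntBL (CB.mem_ofFI hL)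
      (CB.mem_neg mem_zero_one.2) mem_zero_one.1 hL hUa hEa)))) (mem_prefFI ha hb hA hB)

/-- **`J₅ ∈ J5Beq`** (`k_b = k_a = k ≠ 0`). [cite: Moore1966, Theorem 3.1] -/
theorem mem_J5Beq (ha : FI.mem νa Va) (hb : FI.mem νb Vb) (hνa : νa ≠ 0) (hL : FI.mem (νa + νb - 1) LI)
    (hk0 : k ≠ 0) (hok : JOKeq k Va Vb LI = true) :
    CB.mem (J5w νa (k : ℝ) νb (k : ℝ)) (J5Beq k Va Vb LI) := by
  simp only [JOKeq, Bool.and_eq_true] at hok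
  obtain ⟨⟨⟨⟨⟨hA, hB⟩, hE⟩, hU⟩, hUa⟩, hEa⟩ := hok
  have hk' : (k : ℝ) ≠ 0 := by exact_mod_cast hk0
  obtain ⟨u1, u2⟩ := u_shapes hk0
  obtain ⟨m1, m2⟩ := mem_uB hU
  rw [J5w_closed_of_eq hνa rfl hk', u1, u2, neg_freq_cast, expQuadIntR_ratCast, pref_mul]
  unfold J5Beq
  exact CB.mem_mulFI (CB.mem_sub
    (CB.mem_mul (mem_phaseB hL k hE) (mem_polyIntB_real (CB.mem_mul (CB.mem_ofFI hL) m1)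
      (CB.mem_sub (CB.mem_neg m1) (CB.mem_mul (CB.mem_ofFI hL) m2)) m2 hL))
    (CB.mem_mul m1 (CB.mem_mul (mem_phaseB hL k hE) (mem_expQuadIntBL (CB.mem_ofFI hL)
      (CB.mem_neg mem_zero_one.2) mem_zero_one.1 hL hUa hEa)))) (mem_prefFI ha hb hA hB)

/-! ### The one-window combination `K = −(8/π)J₁ + 88πJ₂ − 24i(J₃+J₄) − 48π²iJ₅` -/

/-- the combination in box shape (pure algebra; `8/π = overPi 8`). [cite: Zhang2022LandauSiegel, §12 (12.12)–(12.17)] -/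
theorem Kw_shape (J1 J2 J3 J4 J5 : ℂ) :
    -((8 / π : ℝ) : ℂ) * J1 + ((88 * π : ℝ) : ℂ) * J2 - 24 * I * (J3 + J4) - ((48 * π ^ 2 : ℝ) : ℂ) * I * J5
      = -(J1 * (((overPi 8 : ℝ)) : ℂ)) + J2 * (((π * (88 : ℤ) : ℝ)) : ℂ)
        + ((J3 + J4) * I) * (((-24 : ℤ)) : ℂ) + ((J5 * (((π * π * (48 : ℤ) : ℝ)) : ℂ)) * I) * (((-1 : ℤ)) : ℂ) := by
  unfold overPi; push_cast; ring

/-- box of `K` from boxes of the five `J`'s. [cite: Zhang2022LandauSiegel, §12 (12.12)–(12.17)] -/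
def KwOf (B1 B2 B3 B4 B5 : CB) : CB :=
  (((B1.mulFI (overPiFI 8)).neg.add (B2.mulFI (FI.pi.mulInt 88))).add (((B3.add B4).mulI).mulInt (-24))).add
    (((B5.mulFI ((FI.pi.mul FI.pi).mulInt 48)).mulI).mulInt (-1))

/-- inclusion for `KwOf` (flag: `overPiOK 8`). [cite: Moore1966, Theorem 3.1] -/
theorem mem_KwOf {J1 J2 J3 J4 J5 : ℂ} {B1 B2 B3 B4 B5 : CB} (h1 : CB.mem J1 B1) (h2 : CB.mem J2 B2)
    (h3 : CB.mem J3 B3) (h4 : CB.mem J4 B4) (h5 : CB.mem J5 B5) (h8 : overPiOK 8 = true) :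
    CB.mem (-((8 / π : ℝ) : ℂ) * J1 + ((88 * π : ℝ) : ℂ) * J2 - 24 * I * (J3 + J4) - ((48 * π ^ 2 : ℝ) : ℂ) * I * J5)
      (KwOf B1 B2 B3 B4 B5) := by
  rw [Kw_shape]
  unfold KwOf
  exact CB.mem_add (CB.mem_add (CB.mem_add (CB.mem_neg (CB.mem_mulFI h1 (mem_overPiFI h8)))
    (CB.mem_mulFI h2 (FI.mem_mulInt FI.mem_pi 88))) (CB.mem_mulInt (CB.mem_mulI (CB.mem_add h3 h4)) (-24)))
    (CB.mem_mulInt (CB.mem_mulI (CB.mem_mulFI h5 (FI.mem_mulInt (FI.mem_mul FI.mem_pi FI.mem_pi) 48))) (-1))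

/-- **box of `K(ν_a,k_a;ν_b,k_b)`**, `k_b ≠ k_a`. [cite: Zhang2022LandauSiegel, §12 (12.12)–(12.17)] -/
def KwBne (ka kb : ℚ) (Va Vb LI : FI) : CB :=
  KwOf (J1Bne ka kb Va Vb LI) (J2Bne ka kb Va Vb LI) (J3Bne ka kb Va Vb LI) (J4Bne ka kb Va Vb LI)
    (J5Bne ka kb Va Vb LI)

/-- **box of `K(ν_a,k;ν_b,k)`** (resonant). [cite: Zhang2022LandauSiegel, §12 (12.12)–(12.17)] -/
def KwBeq (k : ℚ) (Va Vb LI : FI) : CB :=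
  KwOf (J1Beq k Va Vb LI) (J2Beq k Va Vb LI) (J3Beq k Va Vb LI) (J4Beq k Va Vb LI) (J5Beq k Va Vb LI)

/-- **`K ∈ KwBne`** in the syntactic shape of `discS_eq_window_integrals`. [cite: Moore1966, Theorem 3.1] -/
theorem mem_KwBne (ha : FI.mem νa Va) (hb : FI.mem νb Vb) (hνa : νa ≠ 0) (hνb : νb ≠ 0)
    (hL : FI.mem (νa + νb - 1) LI) (hk : kb - ka ≠ 0) (hka : ka ≠ 0) (hkb : kb ≠ 0)
    (hok : JOKne ka kb Va Vb LI = true) (h8 : overPiOK 8 = true) :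
    CB.mem (-((8 / π : ℝ) : ℂ) * J1w νa (ka : ℝ) νb (kb : ℝ) + ((88 * π : ℝ) : ℂ) * J2w νa (ka : ℝ) νb (kb : ℝ)
        - 24 * I * (J3w νa (ka : ℝ) νb (kb : ℝ) + J4w νa (ka : ℝ) νb (kb : ℝ))
        - ((48 * π ^ 2 : ℝ) : ℂ) * I * J5w νa (ka : ℝ) νb (kb : ℝ)) (KwBne ka kb Va Vb LI) := by
  unfold KwBne
  exact mem_KwOf (mem_J1Bne ha hb hL hk hok) (mem_J2Bne ha hb hνa hνb hL hk hok) (mem_J3Bne ha hb hνb hL hk hok)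
    (mem_J4Bne ha hb hνa hL hk hok) (mem_J5Bne ha hb hνa hL hk hka hkb hok) h8

/-- **`K ∈ KwBeq`** (resonant pair). [cite: Moore1966, Theorem 3.1] -/
theorem mem_KwBeq (ha : FI.mem νa Va) (hb : FI.mem νb Vb) (hνa : νa ≠ 0) (hνb : νb ≠ 0)
    (hL : FI.mem (νa + νb - 1) LI) (hk0 : k ≠ 0) (hok : JOKeq k Va Vb LI = true) (h8 : overPiOK 8 = true) :
    CB.mem (-((8 / π : ℝ) : ℂ) * J1w νa (k : ℝ) νb (k : ℝ) + ((88 * π : ℝ) : ℂ) * J2w νa (k : ℝ) νb (k : ℝ)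
        - 24 * I * (J3w νa (k : ℝ) νb (k : ℝ) + J4w νa (k : ℝ) νb (k : ℝ))
        - ((48 * π ^ 2 : ℝ) : ℂ) * I * J5w νa (k : ℝ) νb (k : ℝ)) (KwBeq k Va Vb LI) := by
  unfold KwBeq
  exact mem_KwOf (mem_J1Beq ha hb hL hok) (mem_J2Beq ha hb hνa hνb hL hok) (mem_J3Beq ha hb hνb hL hok)
    (mem_J4Beq ha hb hνa hL hok) (mem_J5Beq ha hb hνa hL hk0 hok) h8

end Repair

end Literature.NumberTheory.LFunctions.Zhang2022
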